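import Summits.Ventures.HSemireg.Pad4FirstOrderModel

/-!
# Venture HSemireg — PAD-4, the dual functional Ψ and LEMMA Ψ₁ (the Ψ-row of (H1); one-level infeasibility of the
# class-y slice; the sign criterion for negative Ψ; the cell's Ψ tables as kernel certificates)

HONEST FRAMING. Lean index of the computation cell `pub-hsemireg` (S4-PUSH, H2 door PAD-4), typed by the Ventures-side
typer `hodge-lit-semireg-typer-2` on director-hodge g7's ROW SUPPLY order (ladder REQUESTS l.11011 (4), cell INBOX
l.30215; 2026-08-27): «type the refereed 𝔅-lemmas … as `Pad4Tower*.lean` statements + finite certificates in FILE A's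
vocabulary». This file is the first of them: **LEMMA Ψ₁** of gs-eng-2 g48 (cell INBOX l.30104, 2026-08-27T07:14:22Z;
referee ×2 EXACT, NO OBJECTION: s4-ref-2 g9, `s4push/VERDICT-LEMMA-PSI1-…-S4-REF-2-G9-2026-08-27.md` sha16
92ad329d8e1b9aef; the closed form of Ψ ×2 s4-ref-2 g4 e7463c5abd33c4da; class-side correction of the director's
K-uniform sentence: gs-eng-2 g48 l.30224, accepted l.30226). It imports FILE A (`Pad4FirstOrderModel`, p505821) and
speaks about its `Constituent` ∕ `Design` ∕ `H1`.

WHAT Ψ IS (cell record, not re-derived here). `Ψ := avg_{S₄}([uuuu] − 2[1puu] + [11pp])` is a ℚ-linear functional on the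
degree-8 classes of `S⁴ = Π_{f<4} S_f` which ANNIHILATES `ℚ[h] ⊕ W` (PAD4-THEOREM-L v1.2 (6.5), ×2), so the class condition
of (H1) (`ch(E) ∈ ℚ[h] ⊕ W`) implies the «Ψ-row» `Σ_N m·Ψ(N) = Σ_P m·Ψ(P)`. On a balanced constituent with per-factor
block `x_f = (α_f, β_f) ∈ ℤ ⊕ ℤ[i]` it has the CLOSED FORM (×2 s4-ref-2 g4)
`Ψ = (1∕12) Σ_{pairings {fg|hk}} (s_f + s_g − (α_f − α_g)²)(s_h + s_k − (α_h − α_k)²)`, `s = |β|² = c²`, `α = t + c`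
for a letter `t·I + c·ℓ_ζ` — phase-blind. THIS FILE TAKES THE CLOSED FORM AS THE DEFINITION of `psiForm` (per-factor data
`(α_f, s_f)`); the identification with the averaged intersection functional and the annihilation of `ℚ[h] ⊕ W` are the
cell's pencil ×2 and are NOT re-proved in Lean.

CONTENT.
* §1 `psiForm`, `pairTerm` (the closed form); `Constituent.psi` := `psiForm` at `α_f = t + c_f`, `s_f = c_f²` for a FILE A
  constituent `t·h + Σ c_f ℓ_{ζ_f}` (t ≡ layer on the four factors = class y). PROVED: `Constituent.psi_eq_prod`
  **«t ≡ layer ⇒ Ψ = Π_f c_f»** (LEMMA Ψ₁ (a)); hence `psi_nonneg`, and `psi_eq_zero_of_nCharged_ne_four` ∕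
  `psi_pos_of_nCharged_eq_four` («= 0 unless fully charged» — the one sign).
* §2 `Design.psiSum`, `Design.PsiBalanced` — the Ψ-ROW of (H1) as a HYPOTHESIS on a FILE A design (multiplicity by
  repetition, as in FILE A), standing next to FILE A's μ-row `Design.H1` (FILE A §FAITHFULNESS (d): the class condition is
  not imposed there; this is one more of its linear consequences, justified by (6.5) — pencil, cited). PROVED, LEMMA Ψ₁
  (the certificate of record): `Design.not_H1_of_psiBalanced_of_upper` ∕ `_of_lower` — **a class-y design whose fully
  charged constituents all lie on ONE level cannot satisfy the Ψ-row and the μ-row at once** (the Ψ-row forces the fully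
  charged population of that level to be empty, and FILE A's `exists_fullyCharged_of_H1` needs one). This is the uniform
  (any support, charges, multiplicities, K) form of the ×4 Farkas certificates of the two infeasible class-y slices on record
  (D_ML8's: FC = N [ℓℓℓℓ] only; T376's: FC o42–o45 all N). Referee precision P1 («presupposes an FC constituent with m > 0»)
  is automatic here: `H1` (μ ≠ 0) supplies it.
* §3 PROVED sign criterion (COROLLARY of l.30104, (e) of the verdict; the class-side correction l.30224): on ANY per-factor
  data, `psiForm < 0 ⇒` some pairing factor is negative ⇒ **some factor pair has `(α_f − α_g)² > s_f + s_g`** (a LAYER JUMP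
  exceeding the charges — «t-excess»; necessary, not sufficient; NOT «an O-factor»: fully charged nodeless towers have Ψ < 0).
* §4 KERNEL CERTIFICATES (`decide`) on balanced shapes entered in LIGHT-CONE coordinates `(a_f, b_f) ∈ ℕ²` per factor
  (`α = a + b`, `s = (a − b)²`; letters `O = (0,0)`, `ℓ = (1,0)`, `2ℓ = (2,0)`, `3ℓ = (3,0)`, `2I = (1,1)`, `2I+ℓ = (2,1)`,
  `2I+2ℓ = (3,1)`, `4I = (2,2)`, `4I+ℓ = (3,2)`): the five values of l.30104 (`Ψ[O|ℓ|ℓ|2I] = −2∕3`, `Ψ[O|ℓ|ℓ|2I+ℓ] = −4∕3`,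
  `Ψ[ℓℓℓℓ] = 1`, `Ψ[O|O|2I|2I] = 8∕3`, `Ψ[O|O|2I+ℓ|2I+ℓ] = 32∕3`), the «other shapes in play = 0» list, the fully charged
  tower values of l.30224 (`[ℓ|ℓ|ℓ|2I+ℓ] = −1`, `[ℓ|ℓ|ℓ|2I+2ℓ] = −2`, `[ℓ|ℓ|2ℓ|2I+ℓ] = −2∕3`, `[ℓ|ℓ|ℓ|4I] = −4`,
  `[ℓ|ℓ|2I+ℓ|2I+ℓ] = 1`), the two exact balance sums (ML8^G cone N-side, T376^G sparse solution), and the SQUEEZE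
  INSTANCE of gs-eng-2 g48 l.30214 on D_T1's 46-orbit universe (T376^G, 14 416 classes; orbit table = bc5-plan g3
  `hodge-bloch-bc5-plan/work/D_T1_orbit_lut.json`, phase-blind shapes re-derived by this typer): **Ψ < 0 exactly on the
  three N-orbits o35 `[O|ℓ|ℓ|2I+ℓ]`, o38 `[O|ℓ|2ℓ|2I+ℓ]`, o41 `[O|2ℓ|2ℓ|2I+ℓ]`**, Ψ > 0 exactly on o31 and the fully
  charged o42–o45, Ψ = 0 on the other 38.

WHAT IS NOT HERE. The geometric meaning of Ψ and THEOREM-L (6.5) (pencil ×2, cited); the (H1)-LP ∕ Farkas machinery; any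
statement about designs outside class y other than the shape values of §4 (the 𝔅 ∕ (F1) alphabet has no first-order model
in Lean — see the sibling `Pad4TowerLemmaT`); any bundle, sheaf, σ, seed or abelian variety. NOTHING HERE SAYS THAT
HC ∕ HC_CM ∕ HC_AV ∕ W₆ ∕ HC_Kum4Type HOLDS OR FAILS. No `instance`, no notation, no named fact, 0 `sorry`; axioms standard.

SOURCES (cell documents, sha16): gs-eng-2 g48 cell INBOX l.30104 (LEMMA Ψ₁), l.30214 (squeeze instance), l.30224 (class-side
correction); s4-ref-2 g9 verdict 92ad329d8e1b9aef; s4-ref-2 g4 verdict e7463c5abd33c4da (closed form); PAD4-THEOREM-L-search-1.md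
v1.2 66fb170a6cb906b7 (6.5); PAD4-BALANCED-search-1.md v1.6 e2d93ac598b3704c §0 (balanced blocks, `s = |β|²`, `t = α − |β|`);
BC5-PLAN-g3-MEMO.md v2.4 §11 (A) (D_T1 orbit names o0–o45); FILE A `Pad4FirstOrderModel.lean` b6b3015efa20709e (p505821).
-/

namespace Summit.Ventures.HSemireg.Pad4Tower

open Finset Summit.Ventures.HSemireg.Pad4FirstOrder

/-! ## §1 The closed form of Ψ; Ψ = Π c on class y -/

/-- the pairing factor `A_{fg} = s_f + s_g − (α_f − α_g)²` of the closed form of Ψ (per-factor data `α_f`, `s_f = |β_f|²`).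
[cell: s4-ref-2 g4 e7463c5abd33c4da] -/
def pairTerm (α s : Fin 4 → ℚ) (f g : Fin 4) : ℚ := s f + s g - (α f - α g) ^ 2

/-- **Ψ, closed form** (taken as the definition): `Ψ = (1∕12) Σ_{pairings {fg|hk} of the four factors} A_{fg} · A_{hk}`,
the three pairings being `{01|23}, {02|13}, {03|12}`. [cell: gs-eng-2 g47∕g48; ×2 s4-ref-2 g4 e7463c5abd33c4da] -/
def psiForm (α s : Fin 4 → ℚ) : ℚ :=
  (pairTerm α s 0 1 * pairTerm α s 2 3 + pairTerm α s 0 2 * pairTerm α s 1 3 + pairTerm α s 0 3 * pairTerm α s 1 2) / 12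

/-- Ψ of a FILE A constituent `t·h + Σ_f c_f ℓ_{ζ_f}` (class y: the four factor blocks share the apex `t`): per factor
`α_f = t + c_f`, `s_f = c_f²` (PAD4-BALANCED §0: `β = c ζ̄`, `t = α − |β|`). Phase-blind. -/
def _root_.Summit.Ventures.HSemireg.Pad4FirstOrder.Constituent.psi (X : Constituent) : ℚ :=
  psiForm (fun f => (X.layer : ℚ) + X.charge f) (fun f => (X.charge f : ℚ) ^ 2)

/-- **LEMMA Ψ₁ (a): on a t ≡ layer constituent Ψ is the product of the four charges** (with a common apex every pairing
factor is `2 c_f c_g`, each pairing gives `4 Π c`, three pairings ∕ 12). [cell: l.30104; ×2 92ad329d8e1b9aef (a)] -/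
theorem _root_.Summit.Ventures.HSemireg.Pad4FirstOrder.Constituent.psi_eq_prod (X : Constituent) :
    X.psi = ∏ f, (X.charge f : ℚ) := by
  simp only [Constituent.psi, psiForm, pairTerm, Fin.prod_univ_four]
  ring

/-- Ψ ≥ 0 on class y. -/
theorem _root_.Summit.Ventures.HSemireg.Pad4FirstOrder.Constituent.psi_nonneg (X : Constituent) : 0 ≤ X.psi := by
  rw [X.psi_eq_prod]
  exact Finset.prod_nonneg fun f _ => by positivity

/-- «= 0 unless fully charged»: a constituent with some zero charge has Ψ = 0. -/
theorem _root_.Summit.Ventures.HSemireg.Pad4FirstOrder.Constituent.psi_eq_zero_of_nCharged_ne_four (X : Constituent)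
    (h : X.nCharged ≠ 4) : X.psi = 0 := by
  rw [X.psi_eq_prod]
  have : ∃ g, X.charge g = 0 := by
    by_contra hne
    push Not at hne
    apply h
    unfold Constituent.nCharged
    rw [Finset.filter_true_of_mem (fun g _ => hne g)]
    simp
  obtain ⟨g, hg⟩ := this
  exact Finset.prod_eq_zero (Finset.mem_univ g) (by simp [hg])

/-- a fully charged constituent has Ψ = Π c_f > 0 (the «μ-carriers» are «Ψ-positive»). -/
theorem _root_.Summit.Ventures.HSemireg.Pad4FirstOrder.Constituent.psi_pos_of_nCharged_eq_four (X : Constituent)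
    (h : X.nCharged = 4) : 0 < X.psi := by
  rw [X.psi_eq_prod]
  apply Finset.prod_pos
  intro g _
  have hg : X.charge g ≠ 0 := by
    unfold Constituent.nCharged at h
    have hall : (univ.filter fun g : Fin 4 => X.charge g ≠ 0) = univ :=
      Finset.eq_univ_of_card _ (by simpa using h)
    have := Finset.mem_univ g
    rw [← hall, Finset.mem_filter] at this
    exact this.2
  positivity

/-! ## §2 The Ψ-row of (H1) on a FILE A design, and LEMMA Ψ₁ (one-level infeasibility) -/

/-- the Ψ-mass of a list of constituents (multiplicity by repetition, as in FILE A). -/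
def psiSum (l : List Constituent) : ℚ := (l.map Constituent.psi).sum

/-- **the Ψ-row of (H1)** on a FILE A design: `Σ_N Ψ(N) = Σ_P Ψ(P)`. A HYPOTHESIS standing for the Ψ-component of the
class condition `ch(E) ∈ ℚ[h] ⊕ W` (Ψ annihilates `ℚ[h] ⊕ W`: PAD4-THEOREM-L (6.5), pencil ×2) — the companion of FILE A's
μ-row `Design.H1` (FILE A §FAITHFULNESS (d) imposes neither the class condition nor (Ψ); this predicate names the latter). -/
def _root_.Summit.Ventures.HSemireg.Pad4FirstOrder.Design.PsiBalanced (D : Design) : Prop :=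
  psiSum D.lower = psiSum D.upper

/-- Ψ-mass is non-negative on class y. -/
theorem psiSum_nonneg (l : List Constituent) : 0 ≤ psiSum l :=
  List.sum_nonneg (by
    intro x hx
    obtain ⟨X, -, rfl⟩ := List.mem_map.1 hx
    exact X.psi_nonneg)

/-- a level without fully charged constituents has Ψ-mass 0. -/
theorem psiSum_eq_zero_of_forall {l : List Constituent} (h : ∀ X ∈ l, X.nCharged ≠ 4) : psiSum l = 0 := by
  apply List.sum_eq_zero
  intro x hx
  obtain ⟨X, hX, rfl⟩ := List.mem_map.1 hx
  exact X.psi_eq_zero_of_nCharged_ne_four (h X hX)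

/-- Ψ-mass 0 on a level ⇒ that level has no fully charged constituent (all terms are ≥ 0, the FC ones > 0). -/
theorem forall_nCharged_ne_four_of_psiSum_eq_zero {l : List Constituent} (h : psiSum l = 0) :
    ∀ X ∈ l, X.nCharged ≠ 4 := by
  intro X hX h4
  have hle : X.psi ≤ psiSum l :=
    List.single_le_sum (fun x hx => by
      obtain ⟨Y, -, rfl⟩ := List.mem_map.1 hx
      exact Y.psi_nonneg) _ (List.mem_map.2 ⟨X, hX, rfl⟩)
  have hpos := X.psi_pos_of_nCharged_eq_four h4
  linarith

/-- **LEMMA Ψ₁ (one-level infeasibility), upper level empty of FC.** If the Ψ-row holds and NO `P`-summand is fully charged,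
then no `N`-summand is fully charged either, hence (FILE A `exists_fullyCharged_of_H1`) the μ-row fails: `¬ H1`. In the
cell's words: a t ≡ layer support whose fully charged classes lie on ONE level is (H1)-infeasible for every K and every
multiplicity vector (dual vector = Ψ). [cell: gs-eng-2 g48 l.30104; ×2 s4-ref-2 g9 92ad329d8e1b9aef (d), P1 automatic] -/
theorem _root_.Summit.Ventures.HSemireg.Pad4FirstOrder.Design.not_H1_of_psiBalanced_of_upper (D : Design)
    (hΨ : D.PsiBalanced) (hP : ∀ X ∈ D.upper, X.nCharged ≠ 4) : ¬ D.H1 := by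
  intro h1
  have hup : psiSum D.upper = 0 := psiSum_eq_zero_of_forall hP
  have hlow : psiSum D.lower = 0 := by rw [show psiSum D.lower = psiSum D.upper from hΨ, hup]
  have hN := forall_nCharged_ne_four_of_psiSum_eq_zero hlow
  obtain ⟨X, hX, h4⟩ := exists_fullyCharged_of_H1 D h1
  rcases List.mem_append.1 hX with hl | hu
  · exact hN X hl h4
  · exact hP X hu h4

/-- **LEMMA Ψ₁ (one-level infeasibility), lower level empty of FC** (the mirror statement). -/
theorem _root_.Summit.Ventures.HSemireg.Pad4FirstOrder.Design.not_H1_of_psiBalanced_of_lower (D : Design)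
    (hΨ : D.PsiBalanced) (hN : ∀ X ∈ D.lower, X.nCharged ≠ 4) : ¬ D.H1 := by
  intro h1
  have hlow : psiSum D.lower = 0 := psiSum_eq_zero_of_forall hN
  have hup : psiSum D.upper = 0 := by rw [← show psiSum D.lower = psiSum D.upper from hΨ, hlow]
  have hP := forall_nCharged_ne_four_of_psiSum_eq_zero hup
  obtain ⟨X, hX, h4⟩ := exists_fullyCharged_of_H1 D h1
  rcases List.mem_append.1 hX with hl | hu
  · exact hN X hl h4
  · exact hP X hu h4

/-- LEMMA Ψ₁ in the director's shape: under the Ψ-row, (H1) needs fully charged constituents on BOTH levels. -/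
theorem _root_.Summit.Ventures.HSemireg.Pad4FirstOrder.Design.exists_fc_both_levels_of_H1 (D : Design)
    (hΨ : D.PsiBalanced) (h1 : D.H1) :
    (∃ X ∈ D.lower, X.nCharged = 4) ∧ (∃ X ∈ D.upper, X.nCharged = 4) := by
  constructor
  · by_contra h
    push Not at h
    exact D.not_H1_of_psiBalanced_of_lower hΨ h h1
  · by_contra h
    push Not at h
    exact D.not_H1_of_psiBalanced_of_upper hΨ h h1

/-! ## §3 The sign criterion (COROLLARY of l.30104; class-side correction l.30224) -/

/-- if all three pairing products are ≥ 0 then Ψ ≥ 0. -/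
theorem psiForm_nonneg_of_pairings (α s : Fin 4 → ℚ)
    (h01 : 0 ≤ pairTerm α s 0 1 * pairTerm α s 2 3) (h02 : 0 ≤ pairTerm α s 0 2 * pairTerm α s 1 3)
    (h03 : 0 ≤ pairTerm α s 0 3 * pairTerm α s 1 2) : 0 ≤ psiForm α s := by
  unfold psiForm
  positivity

/-- **negative Ψ needs a negative pairing product** (l.30224: «Ψ < 0 ⟺ an odd number of the three pairing products is
negative»; only the necessity direction is a theorem — the sum of three products of mixed signs can have either sign). -/
theorem exists_pairing_neg_of_psiForm_neg (α s : Fin 4 → ℚ) (h : psiForm α s < 0) :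
    pairTerm α s 0 1 * pairTerm α s 2 3 < 0 ∨ pairTerm α s 0 2 * pairTerm α s 1 3 < 0 ∨
      pairTerm α s 0 3 * pairTerm α s 1 2 < 0 := by
  by_contra hc
  push Not at hc
  obtain ⟨h1, h2, h3⟩ := hc
  exact absurd h (not_lt.mpr (psiForm_nonneg_of_pairings α s h1 h2 h3))

/-- a negative product of two rationals has a negative factor. -/
theorem neg_or_neg_of_mul_neg {x y : ℚ} (h : x * y < 0) : x < 0 ∨ y < 0 := by
  rcases lt_or_ge x 0 with hx | hx
  · exact Or.inl hx
  · right
    by_contra hy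
    push Not at hy
    exact absurd h (not_lt.mpr (mul_nonneg hx hy))

/-- **SIGN CRITERION (t-excess is necessary for negative Ψ).** With non-negative `s_f` (squares of charges): `Ψ < 0 ⇒`
some factor pair has `(α_f − α_g)² > s_f + s_g`, i.e. a LAYER JUMP exceeding the charges (l.30104 COROLLARY; ×2
92ad329d8e1b9aef (e): necessary, not claimed sufficient; l.30224: the negative carriers are NOT characterised by an
O-factor — e.g. the fully charged nodeless tower `[ℓ|ℓ|ℓ|2I+ℓ]` has Ψ = −1, §4). -/
theorem exists_layerJump_of_psiForm_neg (α s : Fin 4 → ℚ) (h : psiForm α s < 0) :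
    ∃ f g : Fin 4, f ≠ g ∧ s f + s g < (α f - α g) ^ 2 := by
  have key : ∀ f g : Fin 4, f ≠ g → pairTerm α s f g < 0 → ∃ f g : Fin 4, f ≠ g ∧ s f + s g < (α f - α g) ^ 2 :=
    fun f g hfg hlt => ⟨f, g, hfg, by unfold pairTerm at hlt; linarith⟩
  rcases exists_pairing_neg_of_psiForm_neg α s h with h1 | h2 | h3
  · rcases neg_or_neg_of_mul_neg h1 with h | h
    · exact key 0 1 (by decide) h
    · exact key 2 3 (by decide) h
  · rcases neg_or_neg_of_mul_neg h2 with h | h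
    · exact key 0 2 (by decide) h
    · exact key 1 3 (by decide) h
  · rcases neg_or_neg_of_mul_neg h3 with h | h
    · exact key 0 3 (by decide) h
    · exact key 1 2 (by decide) h

/-! ## §4 Kernel certificates: the cell's Ψ tables on balanced shapes (light-cone coordinates) -/

/-- Ψ of a balanced shape entered in LIGHT-CONE coordinates `(a_f, b_f) ∈ ℕ²` per factor (non-negative orthant of one apex,
either ray; PAD4-BALANCED §1′ (F1ℝ)): `α = a + b`, `s = |β|² = (a − b)²`. -/
def psiLC (Z : Fin 4 → ℕ × ℕ) : ℚ :=
  psiForm (fun f => ((Z f).1 : ℚ) + (Z f).2) (fun f => (((Z f).1 : ℚ) - (Z f).2) ^ 2)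

/-- letter `O = (0,0)` (the apex point). -/
def lO : ℕ × ℕ := (0, 0)
/-- letter `ℓ` (unit null letter on the `a`-ray). -/
def l1 : ℕ × ℕ := (1, 0)
/-- letter `2ℓ`. -/
def l2 : ℕ × ℕ := (2, 0)
/-- letter `3ℓ`. -/
def l3 : ℕ × ℕ := (3, 0)
/-- the node `2I = (1,1)` (pure relative node, `α = 2`, `β = 0`). -/
def n2I : ℕ × ℕ := (1, 1)
/-- the tower `2I + ℓ = (2,1)`. -/
def t2Il : ℕ × ℕ := (2, 1)
/-- the tower `2I + 2ℓ = (3,1)`. -/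
def t2I2l : ℕ × ℕ := (3, 1)
/-- the node `4I = (2,2)`. -/
def n4I : ℕ × ℕ := (2, 2)
/-- the tower `4I + ℓ = (3,2)`. -/
def t4Il : ℕ × ℕ := (3, 2)

/-- **the five values of l.30104** (×2 92ad329d8e1b9aef (b)). [kernel, `decide`] -/
theorem psi_five_values :
    psiLC ![lO, l1, l1, n2I] = -2/3 ∧ psiLC ![lO, l1, l1, t2Il] = -4/3 ∧ psiLC ![l1, l1, l1, l1] = 1 ∧
      psiLC ![lO, lO, n2I, n2I] = 8/3 ∧ psiLC ![lO, lO, t2Il, t2Il] = 32/3 := by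
  decide +kernel

/-- «all other shapes in play have Ψ = 0» (the verdict's list (b)): `[O|O|ℓ|ℓ]`, `[O|O|2ℓ|2I+ℓ]`, `[O|ℓ|ℓ|ℓ]`, `[O|O|O|ℓ]`,
`[O|O|ℓ|2I+ℓ]`. [kernel, `decide`] -/
theorem psi_zero_shapes :
    psiLC ![lO, lO, l1, l1] = 0 ∧ psiLC ![lO, lO, l2, t2Il] = 0 ∧ psiLC ![lO, l1, l1, l1] = 0 ∧
      psiLC ![lO, lO, lO, l1] = 0 ∧ psiLC ![lO, lO, l1, t2Il] = 0 := by
  decide +kernel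

/-- **fully charged towers with negative Ψ and no O-factor** (gs-eng-2 g48 l.30224, director l.30226: the negative carriers
are t-excess shapes, NOT O-factor shapes): `[ℓ|ℓ|ℓ|2I+ℓ] = −1`, `[ℓ|ℓ|ℓ|2I+2ℓ] = −2`, `[ℓ|ℓ|2ℓ|2I+ℓ] = −2∕3`,
`[ℓ|ℓ|ℓ|4I] = −4`; while `[ℓ|ℓ|2I+ℓ|2I+ℓ] = 1`. [kernel, `decide`] -/
theorem psi_fc_towers :
    psiLC ![l1, l1, l1, t2Il] = -1 ∧ psiLC ![l1, l1, l1, t2I2l] = -2 ∧ psiLC ![l1, l1, l2, t2Il] = -2/3 ∧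
      psiLC ![l1, l1, l1, n4I] = -4 ∧ psiLC ![l1, l1, t2Il, t2Il] = 1 := by
  decide +kernel

/-- **the two exact balance checks of l.30104** (×2 92ad329d8e1b9aef (c)): the Ψ-row holds on the two (H1)-alive
supports of record — ML8^G cone, N-side, per `k`: `6·8k·Ψ[O|O|2I|2I] + 192·2k·Ψ[O|ℓ|ℓ|2I] + 128k·Ψ[ℓℓℓℓ] = 0`
(`= 128k − 256k + 128k`); T376^G sparse solution (μ = 1 024): `96·Ψ[O|O|2I+ℓ|2I+ℓ] + 2·768·Ψ[O|ℓ|ℓ|2I+ℓ] + 16·64·Ψ[ℓℓℓℓ]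
= 1 024 − 2 048 + 1 024 = 0`. (Only these printed sums are certified; the supports themselves are gs-eng-2's files.) -/
theorem psi_balance_checks (k : ℚ) :
    6 * (8 * k) * psiLC ![lO, lO, n2I, n2I] + 192 * (2 * k) * psiLC ![lO, l1, l1, n2I] +
        128 * k * psiLC ![l1, l1, l1, l1] = 0 ∧
      96 * psiLC ![lO, lO, t2Il, t2Il] + 2 * 768 * psiLC ![lO, l1, l1, t2Il] + 16 * 64 * psiLC ![l1, l1, l1, l1] = 0 := by
  obtain ⟨h1, h2, h3, h4, h5⟩ := psi_five_values
  rw [h1, h2, h3, h4, h5]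
  constructor
  · ring
  · norm_num

/-- The 46 G-orbits of D_T1 = T376^G (14 416 classes; bc5-plan g3 `work/D_T1_orbit_lut.json`, orbit numbering of memo
§11 (A)), as (level, phase-blind light-cone shape, orbit size): `true` = N (E₋), `false` = P (E₊). Shapes sorted by factor;
Ψ is `S₄`-symmetric and phase-blind, so one shape per orbit suffices. [data re-derived by this typer from the json] -/
def dt1Orbits : List (Bool × (Fin 4 → ℕ × ℕ) × ℕ) :=
  [ (false, ![lO, lO, lO, l1], 16), (false, ![lO, lO, lO, l2], 16), (false, ![lO, lO, lO, l3], 16),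
    (false, ![lO, lO, lO, t2Il], 16), (false, ![lO, lO, lO, t2I2l], 16), (false, ![lO, lO, l1, l1], 96),
    (false, ![lO, lO, l1, l2], 192), (false, ![lO, lO, l1, l3], 192), (false, ![lO, lO, l1, t2Il], 192),
    (false, ![lO, lO, l2, l2], 96), (false, ![lO, lO, l2, l3], 192), (false, ![lO, lO, l2, t2Il], 192),
    (false, ![lO, l1, l1, l1], 256), (false, ![lO, l1, l1, l2], 768), (false, ![lO, l1, l2, l2], 768),
    (false, ![lO, l2, l2, l2], 256),
    (true, ![lO, lO, lO, l2], 16), (true, ![lO, lO, lO, l3], 16), (true, ![lO, lO, lO, t2I2l], 16),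
    (true, ![lO, lO, lO, t4Il], 16), (true, ![lO, lO, l1, l1], 96), (true, ![lO, lO, l1, l2], 192),
    (true, ![lO, lO, l1, l3], 192), (true, ![lO, lO, l1, t2Il], 192), (true, ![lO, lO, l1, t2I2l], 192),
    (true, ![lO, lO, l2, l2], 96), (true, ![lO, lO, l2, l3], 192), (true, ![lO, lO, l2, t2Il], 192),
    (true, ![lO, lO, l2, t2I2l], 192), (true, ![lO, lO, l3, l3], 96), (true, ![lO, lO, t2Il, l3], 192),
    (true, ![lO, lO, t2Il, t2Il], 96), (true, ![lO, l1, l1, l1], 256), (true, ![lO, l1, l1, l2], 768),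
    (true, ![lO, l1, l1, l3], 768), (true, ![lO, l1, l1, t2Il], 768), (true, ![lO, l1, l2, l2], 768),
    (true, ![lO, l1, l2, l3], 1536), (true, ![lO, l1, l2, t2Il], 1536), (true, ![lO, l2, l2, l2], 256),
    (true, ![lO, l2, l2, l3], 768), (true, ![lO, l2, l2, t2Il], 768), (true, ![l1, l1, l1, l1], 64),
    (true, ![l1, l1, l1, l2], 256), (true, ![l1, l1, l2, l2], 384), (true, ![l1, l2, l2, l2], 256) ]

/-- bookkeeping: 46 orbits, 14 416 classes. [kernel, `decide`] -/
theorem dt1Orbits_counts : dt1Orbits.length = 46 ∧ (dt1Orbits.map fun o => o.2.2).sum = 14416 := by decide +kernel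

/-- Ψ of the `i`-th orbit of the table. -/
def dt1Psi (i : Fin 46) : ℚ := psiLC (dt1Orbits.getD i (false, ![lO, lO, lO, lO], 0)).2.1

/-- **SQUEEZE INSTANCE (gs-eng-2 g48 l.30214, director l.30215): in D_T1's 46-orbit universe the negative-Ψ carriers are
EXACTLY the three tower N-orbits o35 `[O|ℓ|ℓ|2I+ℓ]` (−4∕3), o38 `[O|ℓ|2ℓ|2I+ℓ]` (−8∕3), o41 `[O|2ℓ|2ℓ|2I+ℓ]` (−16∕3);**
Ψ > 0 exactly on o31 `[O|O|2I+ℓ|2I+ℓ]` (32∕3) and the fully charged o42–o45 (1, 2, 4, 8); Ψ = 0 on the remaining 38.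
(So, by the Ψ-row, every (H1)-alive multiplicity vector on this universe whose Ψ-positive mass (o31 or the FC o42–o45) sits on
level N carries one of o35∕o38∕o41 — the class-side half of the squeeze; the LP statement itself is gs-eng-2's, not re-run
here.) [kernel, `decide`] -/
theorem dt1_negative_carriers :
    (∀ i : Fin 46, dt1Psi i < 0 ↔ (i = 35 ∨ i = 38 ∨ i = 41)) ∧
    (∀ i : Fin 46, 0 < dt1Psi i ↔ (i = 31 ∨ i = 42 ∨ i = 43 ∨ i = 44 ∨ i = 45)) ∧
    dt1Psi 35 = -4/3 ∧ dt1Psi 38 = -8/3 ∧ dt1Psi 41 = -16/3 ∧ dt1Psi 31 = 32/3 ∧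
    dt1Psi 42 = 1 ∧ dt1Psi 43 = 2 ∧ dt1Psi 44 = 4 ∧ dt1Psi 45 = 8 := by
  decide +kernel

end Summit.Ventures.HSemireg.Pad4Tower
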